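import Summits.Ventures.CertifiedManyBodySolver.Observables.MeanFieldClassExclusionLaColumns
import Summits.Ventures.CertifiedManyBodySolver.Certificates.HubbardSquare_n7o8_lower_row473
import Literature.MathematicalPhysics.QuantumLattice.HubbardFermiSeaTangentRows
import Literature.MathematicalPhysics.QuantumLattice.HubbardNNNHoppingEnergyDensityRegionBounds
import Literature.MathematicalPhysics.QuantumLattice.HubbardTTPrimeBoxTransport
import Literature.MathematicalPhysics.QuantumLattice.HubbardEnergyDensityChordBounds
import HarnessLib

/-!
# Ventures/CertifiedManyBodySolver — Observables/MeanFieldClassExclusionObjectE.lean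

HONEST FRAMING: first certified bounds; not a superconductivity verdict; every number certified or labelled float.
A competing-order EXCLUSION removes a named class of candidate ground states; it never says which order is present;
no phase sentence follows.

Cell `hubbard-tc` (MO-S3, D-0096), seat `hubbard-tc-mod-3` (G3), `prover-hubbard-tc-mod-3-g3-0`. The DEEP-`t′` continuation of
`MeanFieldClassExclusionStrip/LaBox/LaColumns.lean`: the S1 boxes of record of the non-La₂CuO₄ validation and hold-out materials,
read on OBJECT E (the `t–t′` effective set, `t″ ≡ 0`), have `t′/t_eff ∈ [−0.57, −0.30]` — outside the `[−3/10, 0]` strip of the La files.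
The two new devices are (i) the TANGENT Fermi-sea rows of `HubbardFermiSeaTangentRows` (built on `HubbardFermiSeaCellRows` §3b/§3c) (kernel `decide`, affine in the density, at
the columns `t′ ∈ {−1/2, −2/5, −3/10}`, read between columns by concavity in `t′`), which floor the free gas with no density transport,
and (ii) the `t′`-CHORD cap at `n = 7/8`, `U = 8`: the chord through the CERTIFIED #473 floor at `t′ = 0` and the CERTIFIED #445 cap at
`t′ = −1/4`, extrapolated to `t′ ≤ −1/4` by joint concavity (`energyDensityTT'_le_extrapolate_line`):
`e(1, t′, 8, 7/8) ≤ −0.8372323499 − 0.6023622600·t′`. Filling transport of the cap (vacuum chord below `7/8`, density chord to the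
half-filling cap #472 above) is linearised in `(n, t′)` by monotonicity, the class constant `(n/2)²` is read above its tangent at the
band's lower edge, and `U` is removed by `doccN_lt_of_cap8` (monotone below `8`, Hartree–Fock Lipschitz above), so every word holds for
ALL `U ≥ U₁`. Words (every GS torus limit `ω` of unit `(rectN n L, S^z = 0)`-sector ground states of `hubbardTorusTT' L 1 t′ U` has
`Re ω(n_{0↑} n_{0↓}) < (n/2)²`, so it is not a non-magnetic quasi-free — Hartree–Fock / singlet BCS, any gap — state, Wick: `docc ≥ (n/2)²`,
Bach–Lieb–Solovej 1994 §2):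

* `ccocE_x010_docc_lt_of` — Na-CCOC (M36) box #28 object E `[7.1, 12.4] × [−0.41, −0.30] × [0.88, 0.92]`: WHOLE box (all `U ≥ 7.1`), cond. #472 only;
* `ccocE_parent_docc_lt_of` — Ca₂CuO₂Cl₂ (M58) hole half `n ∈ [0.99, 1]`: whole, cond. #472;
* `ndE_x0_docc_lt_of` / `ndE_x02_docc_lt_of` — NdNiO₂ (M21) `U ≥ 5.8` / Nd₀.₈Sr₀.₂NiO₂ (M22) `U ≥ 6.5` of `[5.2, 8.5]`, cond. #445 ∧ #473 ∧ #472;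
and, in file 2/2 `MeanFieldClassExclusionObjectEHg.lean` (same devices):
* `hgE_p0125_docc_lt_of` / `hgE_p016_docc_lt_of` — Hg1201 per-column object E (M19b / M19), `t′ ≥ −1/2` part, `U ≥ 6` / `U ≥ 6.4` of `[3.5, 8.8]`;
* `hgE_p0125_deep_docc_lt_of` / `hgE_p016_deep_docc_lt_of` — the slivers `t′ ∈ [−0.54, −1/2]` of the same boxes (the `−1/2` column carried by
  the kinematic Lipschitz bound `1.6212|Δt′|`), `U ≥ 6.5` / `U ≥ 7` ⇒ the WHOLE Hg1201 object-E boxes carry the word for `U ≥ 6.5` / `7.0`;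
* `hgE_P10_p016_docc_lt_of` — Hg1201 at 10 GPa (first pressure column), `U ≥ 6.5` of `[3.0, 8.5]`;
* `lsnoE_x02_docc_lt_of` — La₀.₈Sr₀.₂NiO₂ (M39a, hold-out) `U ≥ 7.4` of `[5.1, 8.4]`.

The cert-num engine of the seat (HOME `hubbard-tc-mod-3/box_words.py`, same rules + interval quadrature) prints the same sub-boxes to
`±0.3` in `U` (EXCLUSION-TABLE §B‴). WHAT THIS IS NOT: a statement about stripes, d-wave order or T_c; the saturated-FM class; tight;
Pr₀.₈Sr₀.₂NiO₂ (M39b, `U/t_eff ≤ 6.8`) carries no kernel word (the test first passes at `U = 7.2`).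

References: T. Koma, H. Tasaki, J. Stat. Phys. 76 (1994) 745, §1 [KomaTasaki1994]; V. Bach, E. H. Lieb, J. P. Solovej,
J. Stat. Phys. 76 (1994) 3, eq. (2c.36) [BachLiebSolovej1994]; E. H. Lieb, M. Loss, Duke Math. J. 71 (1993) 337, §8 Thm 8.2
[LiebLoss1993]; R. B. Israel, Convexity in the Theory of Lattice Gases (1979), Thm I.3.4 [Israel1979]; D. Ruelle,
Statistical Mechanics (1969) §3.3 [Ruelle1969].
-/

noncomputable section

namespace Summit.Ventures.CertifiedManyBodySolver.Observables

open Literature.MathematicalPhysics.QuantumLattice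
open Literature.MathematicalPhysics.QuantumLattice.ThermodynamicLimit
open Summit.Ventures.CertifiedManyBodySolver.Certificates
open Matrix HubbardWave0 Literature.Probability.LatticeModels Filter Topology
open scoped ComplexOrder BigOperators


/-! ### §1 Devices -/

/-- **Floor between two floored columns, any density**: floors `Fa ≤ e(1, a, 0, n)`, `Fb ≤ e(1, b, 0, n)` at `a ≤ b` give
`min Fa Fb ≤ e(1, s, 0, n)` for every `s ∈ [a, b]` — concavity of `t′ ↦ e` (`energyDensityTT'_tPrime_interval_ge_kinematic` with zero
outward margins; the general-`n` form of `strip78_floor_between`). [cite: Israel1979, Thm. I.3.4] -/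
theorem objE_floor_between {a b s n Fa Fb : ℝ} (hn0 : 0 ≤ n) (hn2 : n < 2) (hab : a ≤ b)
    (hFa : Fa ≤ energyDensityTT' 1 a 0 n) (hFb : Fb ≤ energyDensityTT' 1 b 0 n) (has : a ≤ s) (hsb : s ≤ b) :
    min Fa Fb ≤ energyDensityTT' 1 s 0 n := by
  have h := energyDensityTT'_tPrime_interval_ge_kinematic 1 le_rfl hn0 hn2 hab hFa hFb has hsb
  simpa only [sub_self, max_self, mul_zero, sub_zero] using h

/-- **The half-filling cap at `U = 8`, every `t′`**: `e(1, t′, 8, 1) ≤ −0.5087724429` (CERTIFIED #472 at `t′ = 0`, `t′`-even + concave).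
[cite: Israel1979, Thm. I.3.4] -/
theorem objE_halfFilling_cap8 (h472 : cert_r472_pb2_tl_upper_n1_U8) (t' : ℝ) :
    energyDensityTT' 1 t' 8 1 ≤ -0.5087724429 := by
  have h := laBox_halfFilling_cap_of h472 t' (by norm_num : (0 : ℝ) ≤ 8)
  rw [sub_self, max_self, mul_zero, add_zero] at h
  exact h

/-- **The `t′`-CHORD cap at `n = 7/8`, `U = 8`** (new device): for `s ≤ −1/4`,
`e(1, s, 8, 7/8) ≤ −0.8372323499 − 0.6023622600·s` — the chord through the CERTIFIED #473 FLOOR `−0.8372323499 ≤ e(1, 0, 8, 7/8)` and the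
CERTIFIED #445 CAP `e(1, −1/4, 8, 7/8) ≤ −0.6866417849`, extrapolated beyond `−1/4` with `θ = −1 − 4s ≥ 0` (`energyDensityTT'_le_extrapolate_line`:
joint concavity of `(t′, U) ↦ e`). At `s = −1/2` the cap is `−0.5360512199`, against `−0.4451758876` from the half-filling vacuum chord.
[cite: Israel1979, Thm. I.3.4] -/
theorem objE_conc78_cap8 (h445 : cert_dbt329pair_allk)
    (h473 : cert_r473_bs_M3U8tp0_w3_b4_R2_ob5p2_kry1_kry2c3rel_hanK7B4D4_KN4_PR20d4_hanK8c2s_hanK8B4D4_uprime)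
    {s : ℝ} (hs : s ≤ -1 / 4) :
    energyDensityTT' 1 s 8 (7 / 8) ≤ -0.8372323499 + -0.6023622600 * s := by
  have hR := m3_tpm1o4_cap_decimal_of h445
  have hL0 : (((-1012151804787154021296135/1208925819614629174706176) : ℚ) : ℝ) ≤ energyDensityTT' 1 0 8 (7 / 8) := h473
  have hL : (-0.8372323499 : ℝ) ≤ energyDensityTT' 1 0 8 (7 / 8) := le_trans (by norm_num) hL0
  have hθ : (0 : ℝ) ≤ -1 - 4 * s := by linarith
  have h := energyDensityTT'_le_extrapolate_line 1 (n := 7 / 8) (by norm_num) (by norm_num)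
    (s₁ := 0) (U₁ := 8) (s₂ := -1 / 4) (U₂ := 8) (θ := -1 - 4 * s) (by norm_num) hθ (by norm_num) hL hR
  have es : (-1 / 4 : ℝ) + (-1 - 4 * s) * (-1 / 4 - 0) = s := by ring
  have eU : (8 : ℝ) + (-1 - 4 * s) * (8 - 8) = 8 := by ring
  rw [es, eU] at h
  linarith

/-- **Low-band cap at `U = 8` from a `7/8` cap that is affine in `s`**: `e(1, s, 8, 7/8) ≤ A + B·s` with `B·s ≥ 0` gives, for
`0 < n ≤ m ≤ 7/8`, `e(1, s, 8, n) ≤ (8/7)(A·n + B·m·s)` — the vacuum chord `(n/(7/8))(A + Bs)` (convexity in the density, `e(0) ≤ 0`) with the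
bilinear term linearised by `n·(Bs) ≤ m·(Bs)`. [cite: Ruelle1969, §3.3] -/
theorem objE_lowBand_cap8 {s n m A B : ℝ} (hR : energyDensityTT' 1 s 8 (7 / 8) ≤ A + B * s) (hBs : 0 ≤ B * s)
    (hn : 0 < n) (hnm : n ≤ m) (hm : m ≤ 7 / 8) :
    energyDensityTT' 1 s 8 n ≤ 8 / 7 * (A * n + B * m * s) := by
  have h2 : B * s * n ≤ B * m * s := by nlinarith [mul_nonneg hBs (sub_nonneg.2 hnm)]
  have hlin : n / (7 / 8) * (A + B * s) ≤ 8 / 7 * (A * n + B * m * s) := by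
    have e : n / (7 / 8) * (A + B * s) = 8 / 7 * (A * n + B * s * n) := by ring
    rw [e]
    linarith
  rcases eq_or_lt_of_le (le_trans hnm hm) with h78 | h78
  · rw [h78] at hlin ⊢
    have e : (7 / 8 : ℝ) / (7 / 8) * (A + B * s) = A + B * s := by
      rw [div_self (by norm_num : (7 / 8 : ℝ) ≠ 0), one_mul]
    rw [e] at hlin
    exact hR.trans hlin
  · have hv := energyDensityTT'_le_vacuum_chord 1 s (by norm_num : (0 : ℝ) ≤ 8) hn h78 (by norm_num) hR
    exact hv.trans hlin

/-- **High-band cap at `U = 8`**: `e(1, s, 8, 7/8) ≤ A + B·s` (`B·s ≥ 0`) and the half-filling cap `e(1, s, 8, 1) ≤ C` give, for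
`m ≤ n`, `7/8 < n < 1`, `e(1, s, 8, n) ≤ 8((1 − n)A + (1 − m)(Bs) + (n − 7/8)C)` — the density chord between `7/8` and `1`
(convexity) with `(1 − n)(Bs) ≤ (1 − m)(Bs)`. [cite: Ruelle1969, §3.3] -/
theorem objE_highBand_cap8 {s n m A B C : ℝ} (hR : energyDensityTT' 1 s 8 (7 / 8) ≤ A + B * s)
    (hC : energyDensityTT' 1 s 8 1 ≤ C) (hBs : 0 ≤ B * s) (hmn : m ≤ n) (h78 : 7 / 8 < n) (hn1 : n < 1) :
    energyDensityTT' 1 s 8 n ≤ 8 * ((1 - n) * A + (1 - m) * (B * s) + (n - 7 / 8) * C) := by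
  have hd := energyDensityTT'_le_density_chord 1 s (by norm_num : (0 : ℝ) ≤ 8) (n₁ := 7 / 8) (n := n) (n₂ := 1)
    (by norm_num) h78 hn1 (by norm_num) hR hC
  have e1 : ((1 - n) * (A + B * s) + (n - 7 / 8) * C) / (1 - 7 / 8) =
      8 * ((1 - n) * A + (1 - n) * (B * s) + (n - 7 / 8) * C) := by ring
  rw [e1] at hd
  have h2 : (1 - n) * (B * s) ≤ (1 - m) * (B * s) := mul_le_mul_of_nonneg_right (by linarith) hBs
  linarith

/-- **Half-filling vacuum chord at `U = 8`**: `e(1, s, 8, 1) ≤ C` gives `e(1, s, 8, n) ≤ n·C` for `0 < n ≤ 1` (convexity in the density,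
`e(0) ≤ 0`). [cite: Ruelle1969, §3.3] -/
theorem objE_half_cap8 {s n C : ℝ} (hC : energyDensityTT' 1 s 8 1 ≤ C) (hn : 0 < n) (hn1 : n ≤ 1) :
    energyDensityTT' 1 s 8 n ≤ n * C := by
  rcases eq_or_lt_of_le hn1 with h | h
  · rw [h, one_mul]
    exact hC
  · have hv := energyDensityTT'_le_vacuum_chord 1 s (by norm_num : (0 : ℝ) ≤ 8) hn h (by norm_num) hC
    rw [div_one] at hv
    exact hv

/-- **The docc tail with a `U`-threshold**: a cap `e(1, t′, 8, n) ≤ u₈`, a free floor `ℓ ≤ e(1, t′, 0, n)` and ONE linear margin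
`u₈ − ℓ < (n/2)²·U₁` at a threshold `0 < U₁ ≤ 8` give `Re ω(n_{0↑}n_{0↓}) < (n/2)²` for every GS torus limit at every `U ≥ U₁`
(`doccN_lt_of_cap8`: monotone in `U` below `8`, Hartree–Fock Lipschitz slope `(n/2)²` above). [cite: KomaTasaki1994, §1] -/
theorem doccN_lt_of_cap8_threshold {t' U n u8 ℓ U₁ : ℝ} (hU₁ : 0 < U₁) (hU₁8 : U₁ ≤ 8) (hU : U₁ ≤ U)
    (hn0 : 0 ≤ n) (hn2 : n < 2) (hcap8 : energyDensityTT' 1 t' 8 n ≤ u8) (hℓ : ℓ ≤ energyDensityTT' 1 t' 0 n)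
    (hlin : u8 - ℓ < (n / 2) ^ 2 * U₁) :
    ∀ (ω : InfVolFermionState 2) (Ls : ℕ → ℕ) (ψ : ∀ L, Fock (Orb (FermionTorus 2 L))),
      Tendsto Ls atTop atTop →
      (∀ j, IsGroundStateInSector (hubbardTorusTT' (Ls j) 1 t' U) (rectN n (Ls j)) 0 (ψ (Ls j))) →
      (∀ j, star (ψ (Ls j)) ⬝ᵥ ψ (Ls j) = 1) → ω.IsTorusLimitOf ψ Ls →
      (ω.expect ({0} : Finset (Site 2))
        (nAt 0 (Finset.mem_singleton_self 0) 0 * nAt 0 (Finset.mem_singleton_self 0) 1)).re < (n / 2) ^ 2 := by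
  have hU0 : 0 < U := lt_of_lt_of_le hU₁ hU
  have hsq : 0 ≤ (n / 2) ^ 2 := sq_nonneg _
  have hlinU : u8 - ℓ < (n / 2) ^ 2 * U := lt_of_lt_of_le hlin (mul_le_mul_of_nonneg_left hU hsq)
  have hlin8 : u8 - ℓ < 8 * (n / 2) ^ 2 := by nlinarith [mul_le_mul_of_nonneg_left hU₁8 hsq]
  exact doccN_lt_of_cap8 hU0 hn0 hn2 hcap8 hℓ hlinU hlin8

/-- Elementary: `u − a < X` and `u − b < X` give `u − min a b < X`. [folklore] -/
theorem sub_min_lt_of {u a b X : ℝ} (h1 : u - a < X) (h2 : u - b < X) : u - min a b < X := by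
  rcases min_choice a b with h | h <;> rw [h] <;> assumption


/-! ### §2 The words on the object-E boxes of record: Na-CCOC and NdNiO₂ (Hg1201 and the R-nickelates: `MeanFieldClassExclusionObjectEHg.lean`) -/

/-- **Na-CCOC Ca₁.₉Na₀.₁CuO₂Cl₂ (VSET M36), BOX OF RECORD #28, OBJECT E — MF/BCS class excluded on the WHOLE box.**
Assume the claim node of CERTIFIED #472. For every `t′ ∈ [−41/100, −3/10]`, EVERY `U ≥ 71/10` (the box is `U/t_eff ∈ [7.1, 12.4]`) and
`n ∈ [22/25, 23/25]`, every GS torus limit has `Re ω(n_{0↑}n_{0↓}) < (n/2)²`. Cap = vacuum chord of the half-filling cap #472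
(`t′`-even + concave ⇒ zero `t′`-loss), floor = tangent Fermi-sea rows at `n₀ = 9/10` read between the columns `−1/2, −2/5, −3/10` by concavity;
smallest linear margin `+0.234`. [cite: KomaTasaki1994, §1] [cite: BachLiebSolovej1994, eq. (2c.36)] [cite: LiebLoss1993, §8, Theorem 8.2] -/
theorem ccocE_x010_docc_lt_of (h472 : cert_r472_pb2_tl_upper_n1_U8)
    {t' U n : ℝ} (ht1 : -41 / 100 ≤ t') (ht2 : t' ≤ -3 / 10) (hU : 71 / 10 ≤ U)
    (hn1 : 22 / 25 ≤ n) (hn2 : n ≤ 23 / 25) :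
    ∀ (ω : InfVolFermionState 2) (Ls : ℕ → ℕ) (ψ : ∀ L, Fock (Orb (FermionTorus 2 L))),
      Tendsto Ls atTop atTop →
      (∀ j, IsGroundStateInSector (hubbardTorusTT' (Ls j) 1 t' U) (rectN n (Ls j)) 0 (ψ (Ls j))) →
      (∀ j, star (ψ (Ls j)) ⬝ᵥ ψ (Ls j) = 1) → ω.IsTorusLimitOf ψ Ls →
      (ω.expect ({0} : Finset (Site 2))
        (nAt 0 (Finset.mem_singleton_self 0) 0 * nAt 0 (Finset.mem_singleton_self 0) 1)).re < (n / 2) ^ 2 := by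
  have hn0 : (0 : ℝ) ≤ n := by linarith
  have hn2' : n < 2 := by linarith
  have hnpos : (0 : ℝ) < n := by linarith
  -- the class constant `(n/2)²` above its tangent at `n = 22 / 25`, scaled by the threshold `U₁ = 71 / 10`
  have hsq : (-121 / 625 : ℝ) + 11 / 25 * n ≤ (n / 2) ^ 2 := by nlinarith [sq_nonneg (n - 22 / 25)]
  have hsqU : ((-121 / 625 : ℝ) + 11 / 25 * n) * (71 / 10) ≤ (n / 2) ^ 2 * (71 / 10) :=
    mul_le_mul_of_nonneg_right hsq (by norm_num)
  have hC8 := objE_halfFilling_cap8 h472 t'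
  have ra := fermiSeaTangentRow_tPrime_neg_one_div_two_at_nine_div_ten (U := 0) le_rfl hn0 hn2'
  have rb := fermiSeaTangentRow_tPrime_neg_two_div_five_at_nine_div_ten (U := 0) le_rfl hn0 hn2'
  have rc := fermiSeaTangentRow_tPrime_neg_three_div_ten_at_nine_div_ten (U := 0) le_rfl hn0 hn2'
  rcases le_or_gt t' (-2 / 5) with hp | hp
  · -- piece `t' ∈ [-41 / 100, -2/5]`: columns `-1/2`, `-2/5`
    have hfl := objE_floor_between hn0 hn2' (by norm_num : (-1 / 2 : ℝ) ≤ -2 / 5) ra rb (by linarith) hp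
    have hcap := objE_half_cap8 hC8 hnpos (by linarith)
    exact doccN_lt_of_cap8_threshold (U₁ := 71 / 10) (by norm_num) (by norm_num) hU hn0 hn2' hcap hfl
      (sub_min_lt_of (by linarith) (by linarith))
  · -- piece `t' ∈ (-2/5, -3 / 10]`: columns `-2/5`, `-3/10`
    have hfl := objE_floor_between hn0 hn2' (by norm_num : (-2 / 5 : ℝ) ≤ -3 / 10) rb rc hp.le (by linarith)
    have hcap := objE_half_cap8 hC8 hnpos (by linarith)
    exact doccN_lt_of_cap8_threshold (U₁ := 71 / 10) (by norm_num) (by norm_num) hU hn0 hn2' hcap hfl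
      (sub_min_lt_of (by linarith) (by linarith))

/-- **Ca₂CuO₂Cl₂ parent (VSET v2 M58), same box #28 at the parent filling, OBJECT E, hole half `n ∈ [99/100, 1]` — MF/BCS class
excluded on the whole (half-)box**: `t′ ∈ [−41/100, −3/10]`, every `U ≥ 71/10`; tangent rows at `n₀ = 1`; smallest margin `+0.530`. (The particle
half `n ∈ (1, 1.01]` is the `(t′, n) ↦ (−t′, 2 − n)` mirror and stays cert-num, as for La M13.) [cite: KomaTasaki1994, §1] [cite: BachLiebSolovej1994, eq. (2c.36)] [cite: LiebLoss1993, §8, Theorem 8.2] -/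
theorem ccocE_parent_docc_lt_of (h472 : cert_r472_pb2_tl_upper_n1_U8)
    {t' U n : ℝ} (ht1 : -41 / 100 ≤ t') (ht2 : t' ≤ -3 / 10) (hU : 71 / 10 ≤ U)
    (hn1 : 99 / 100 ≤ n) (hn2 : n ≤ 1) :
    ∀ (ω : InfVolFermionState 2) (Ls : ℕ → ℕ) (ψ : ∀ L, Fock (Orb (FermionTorus 2 L))),
      Tendsto Ls atTop atTop →
      (∀ j, IsGroundStateInSector (hubbardTorusTT' (Ls j) 1 t' U) (rectN n (Ls j)) 0 (ψ (Ls j))) →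
      (∀ j, star (ψ (Ls j)) ⬝ᵥ ψ (Ls j) = 1) → ω.IsTorusLimitOf ψ Ls →
      (ω.expect ({0} : Finset (Site 2))
        (nAt 0 (Finset.mem_singleton_self 0) 0 * nAt 0 (Finset.mem_singleton_self 0) 1)).re < (n / 2) ^ 2 := by
  have hn0 : (0 : ℝ) ≤ n := by linarith
  have hn2' : n < 2 := by linarith
  have hnpos : (0 : ℝ) < n := by linarith
  -- the class constant `(n/2)²` above its tangent at `n = 99 / 100`, scaled by the threshold `U₁ = 71 / 10`
  have hsq : (-9801 / 40000 : ℝ) + 99 / 200 * n ≤ (n / 2) ^ 2 := by nlinarith [sq_nonneg (n - 99 / 100)]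
  have hsqU : ((-9801 / 40000 : ℝ) + 99 / 200 * n) * (71 / 10) ≤ (n / 2) ^ 2 * (71 / 10) :=
    mul_le_mul_of_nonneg_right hsq (by norm_num)
  have hC8 := objE_halfFilling_cap8 h472 t'
  have ra := fermiSeaTangentRow_tPrime_neg_one_div_two_at_one (U := 0) le_rfl hn0 hn2'
  have rb := fermiSeaTangentRow_tPrime_neg_two_div_five_at_one (U := 0) le_rfl hn0 hn2'
  have rc := fermiSeaTangentRow_tPrime_neg_three_div_ten_at_one (U := 0) le_rfl hn0 hn2'
  rcases le_or_gt t' (-2 / 5) with hp | hp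
  · -- piece `t' ∈ [-41 / 100, -2/5]`: columns `-1/2`, `-2/5`
    have hfl := objE_floor_between hn0 hn2' (by norm_num : (-1 / 2 : ℝ) ≤ -2 / 5) ra rb (by linarith) hp
    have hcap := objE_half_cap8 hC8 hnpos (by linarith)
    exact doccN_lt_of_cap8_threshold (U₁ := 71 / 10) (by norm_num) (by norm_num) hU hn0 hn2' hcap hfl
      (sub_min_lt_of (by linarith) (by linarith))
  · -- piece `t' ∈ (-2/5, -3 / 10]`: columns `-2/5`, `-3/10`
    have hfl := objE_floor_between hn0 hn2' (by norm_num : (-2 / 5 : ℝ) ≤ -3 / 10) rb rc hp.le (by linarith)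
    have hcap := objE_half_cap8 hC8 hnpos (by linarith)
    exact doccN_lt_of_cap8_threshold (U₁ := 71 / 10) (by norm_num) (by norm_num) hU hn0 hn2' hcap hfl
      (sub_min_lt_of (by linarith) (by linarith))

/-- **NdNiO₂ (VSET M21), OBJECT E `[5.2, 8.5] × [−0.46, −0.36] × [0.84, 0.90]` — MF/BCS class excluded on the sub-box `U ≥ 29/5`**
(every `U ≥ 5.8`, so `[5.8, 8.5]` of the box and beyond). Assume the claim nodes of CERTIFIED #445, #473, #472. Cap at `U = 8` = the
`t′`-chord of #445 (at `−1/4`) over the #473 floor (at `0`) extrapolated to `t′ ≤ −1/4` at `n = 7/8`, then vacuum chord (`n ≤ 7/8`) / density chord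
to the half-filling cap #472 (`n ≥ 7/8`); floor = tangent rows at `n₀ = 7/8`; `U ≠ 8` by `doccN_lt_of_cap8`; smallest margin `+0.014`. [cite: KomaTasaki1994, §1] [cite: BachLiebSolovej1994, eq. (2c.36)] [cite: LiebLoss1993, §8, Theorem 8.2] -/
theorem ndE_x0_docc_lt_of (h445 : cert_dbt329pair_allk)
    (h473 : cert_r473_bs_M3U8tp0_w3_b4_R2_ob5p2_kry1_kry2c3rel_hanK7B4D4_KN4_PR20d4_hanK8c2s_hanK8B4D4_uprime)
    (h472 : cert_r472_pb2_tl_upper_n1_U8)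
    {t' U n : ℝ} (ht1 : -23 / 50 ≤ t') (ht2 : t' ≤ -9 / 25) (hU : 29 / 5 ≤ U)
    (hn1 : 21 / 25 ≤ n) (hn2 : n ≤ 9 / 10) :
    ∀ (ω : InfVolFermionState 2) (Ls : ℕ → ℕ) (ψ : ∀ L, Fock (Orb (FermionTorus 2 L))),
      Tendsto Ls atTop atTop →
      (∀ j, IsGroundStateInSector (hubbardTorusTT' (Ls j) 1 t' U) (rectN n (Ls j)) 0 (ψ (Ls j))) →
      (∀ j, star (ψ (Ls j)) ⬝ᵥ ψ (Ls j) = 1) → ω.IsTorusLimitOf ψ Ls →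
      (ω.expect ({0} : Finset (Site 2))
        (nAt 0 (Finset.mem_singleton_self 0) 0 * nAt 0 (Finset.mem_singleton_self 0) 1)).re < (n / 2) ^ 2 := by
  have hn0 : (0 : ℝ) ≤ n := by linarith
  have hn2' : n < 2 := by linarith
  have hnpos : (0 : ℝ) < n := by linarith
  -- the class constant `(n/2)²` above its tangent at `n = 21 / 25`, scaled by the threshold `U₁ = 29 / 5`
  have hsq : (-441 / 2500 : ℝ) + 21 / 50 * n ≤ (n / 2) ^ 2 := by nlinarith [sq_nonneg (n - 21 / 25)]
  have hsqU : ((-441 / 2500 : ℝ) + 21 / 50 * n) * (29 / 5) ≤ (n / 2) ^ 2 * (29 / 5) :=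
    mul_le_mul_of_nonneg_right hsq (by norm_num)
  have hC8 := objE_halfFilling_cap8 h472 t'
  have hR := objE_conc78_cap8 h445 h473 (s := t') (by linarith)
  have hBs : (0 : ℝ) ≤ -0.6023622600 * t' := mul_nonneg_of_nonpos_of_nonpos (by norm_num) (by linarith)
  have ra := fermiSeaTangentRow_tPrime_neg_one_div_two_at_seven_div_eight (U := 0) le_rfl hn0 hn2'
  have rb := fermiSeaTangentRow_tPrime_neg_two_div_five_at_seven_div_eight (U := 0) le_rfl hn0 hn2'
  have rc := fermiSeaTangentRow_tPrime_neg_three_div_ten_at_seven_div_eight (U := 0) le_rfl hn0 hn2'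
  rcases le_or_gt t' (-2 / 5) with hp | hp
  · -- piece `t' ∈ [-23 / 50, -2/5]`: columns `-1/2`, `-2/5`
    have hfl := objE_floor_between hn0 hn2' (by norm_num : (-1 / 2 : ℝ) ≤ -2 / 5) ra rb (by linarith) hp
    rcases le_or_gt n (7 / 8) with hb | hb
    · have hcap := objE_lowBand_cap8 hR hBs hnpos hb le_rfl
      exact doccN_lt_of_cap8_threshold (U₁ := 29 / 5) (by norm_num) (by norm_num) hU hn0 hn2' hcap hfl
        (sub_min_lt_of (by linarith) (by linarith))
    · have hcap := objE_highBand_cap8 hR hC8 hBs (m := 7 / 8) hb.le hb (by linarith)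
      exact doccN_lt_of_cap8_threshold (U₁ := 29 / 5) (by norm_num) (by norm_num) hU hn0 hn2' hcap hfl
        (sub_min_lt_of (by linarith) (by linarith))
  · -- piece `t' ∈ (-2/5, -9 / 25]`: columns `-2/5`, `-3/10`
    have hfl := objE_floor_between hn0 hn2' (by norm_num : (-2 / 5 : ℝ) ≤ -3 / 10) rb rc hp.le (by linarith)
    rcases le_or_gt n (7 / 8) with hb | hb
    · have hcap := objE_lowBand_cap8 hR hBs hnpos hb le_rfl
      exact doccN_lt_of_cap8_threshold (U₁ := 29 / 5) (by norm_num) (by norm_num) hU hn0 hn2' hcap hfl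
        (sub_min_lt_of (by linarith) (by linarith))
    · have hcap := objE_highBand_cap8 hR hC8 hBs (m := 7 / 8) hb.le hb (by linarith)
      exact doccN_lt_of_cap8_threshold (U₁ := 29 / 5) (by norm_num) (by norm_num) hU hn0 hn2' hcap hfl
        (sub_min_lt_of (by linarith) (by linarith))

/-- **Nd₀.₈Sr₀.₂NiO₂ (VSET M22), OBJECT E `[5.2, 8.5] × [−0.46, −0.36] × [0.78, 0.84]` — MF/BCS class excluded on the sub-box
`U ≥ 13/2`.** Claim nodes #445, #473 (the band lies below `7/8`: no half-filling cap needed); tangent rows at `n₀ = 21/25`; smallest margin `+0.016`. [cite: KomaTasaki1994, §1] [cite: BachLiebSolovej1994, eq. (2c.36)] [cite: LiebLoss1993, §8, Theorem 8.2] -/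
theorem ndE_x02_docc_lt_of (h445 : cert_dbt329pair_allk)
    (h473 : cert_r473_bs_M3U8tp0_w3_b4_R2_ob5p2_kry1_kry2c3rel_hanK7B4D4_KN4_PR20d4_hanK8c2s_hanK8B4D4_uprime)
    {t' U n : ℝ} (ht1 : -23 / 50 ≤ t') (ht2 : t' ≤ -9 / 25) (hU : 13 / 2 ≤ U)
    (hn1 : 39 / 50 ≤ n) (hn2 : n ≤ 21 / 25) :
    ∀ (ω : InfVolFermionState 2) (Ls : ℕ → ℕ) (ψ : ∀ L, Fock (Orb (FermionTorus 2 L))),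
      Tendsto Ls atTop atTop →
      (∀ j, IsGroundStateInSector (hubbardTorusTT' (Ls j) 1 t' U) (rectN n (Ls j)) 0 (ψ (Ls j))) →
      (∀ j, star (ψ (Ls j)) ⬝ᵥ ψ (Ls j) = 1) → ω.IsTorusLimitOf ψ Ls →
      (ω.expect ({0} : Finset (Site 2))
        (nAt 0 (Finset.mem_singleton_self 0) 0 * nAt 0 (Finset.mem_singleton_self 0) 1)).re < (n / 2) ^ 2 := by
  have hn0 : (0 : ℝ) ≤ n := by linarith
  have hn2' : n < 2 := by linarith
  have hnpos : (0 : ℝ) < n := by linarith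
  -- the class constant `(n/2)²` above its tangent at `n = 39 / 50`, scaled by the threshold `U₁ = 13 / 2`
  have hsq : (-1521 / 10000 : ℝ) + 39 / 100 * n ≤ (n / 2) ^ 2 := by nlinarith [sq_nonneg (n - 39 / 50)]
  have hsqU : ((-1521 / 10000 : ℝ) + 39 / 100 * n) * (13 / 2) ≤ (n / 2) ^ 2 * (13 / 2) :=
    mul_le_mul_of_nonneg_right hsq (by norm_num)
  have hR := objE_conc78_cap8 h445 h473 (s := t') (by linarith)
  have hBs : (0 : ℝ) ≤ -0.6023622600 * t' := mul_nonneg_of_nonpos_of_nonpos (by norm_num) (by linarith)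
  have ra := fermiSeaTangentRow_tPrime_neg_one_div_two_at_twentyone_div_twentyfive (U := 0) le_rfl hn0 hn2'
  have rb := fermiSeaTangentRow_tPrime_neg_two_div_five_at_twentyone_div_twentyfive (U := 0) le_rfl hn0 hn2'
  have rc := fermiSeaTangentRow_tPrime_neg_three_div_ten_at_twentyone_div_twentyfive (U := 0) le_rfl hn0 hn2'
  rcases le_or_gt t' (-2 / 5) with hp | hp
  · -- piece `t' ∈ [-23 / 50, -2/5]`: columns `-1/2`, `-2/5`
    have hfl := objE_floor_between hn0 hn2' (by norm_num : (-1 / 2 : ℝ) ≤ -2 / 5) ra rb (by linarith) hp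
    have hcap := objE_lowBand_cap8 hR hBs hnpos hn2 (by norm_num)
    exact doccN_lt_of_cap8_threshold (U₁ := 13 / 2) (by norm_num) (by norm_num) hU hn0 hn2' hcap hfl
      (sub_min_lt_of (by linarith) (by linarith))
  · -- piece `t' ∈ (-2/5, -9 / 25]`: columns `-2/5`, `-3/10`
    have hfl := objE_floor_between hn0 hn2' (by norm_num : (-2 / 5 : ℝ) ≤ -3 / 10) rb rc hp.le (by linarith)
    have hcap := objE_lowBand_cap8 hR hBs hnpos hn2 (by norm_num)
    exact doccN_lt_of_cap8_threshold (U₁ := 13 / 2) (by norm_num) (by norm_num) hU hn0 hn2' hcap hfl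
      (sub_min_lt_of (by linarith) (by linarith))

/-! ### §3 A sharper between-columns floor for successors (appended 2026-08-27, g3): the CHORD of two column floors -/

/-- **Chord floor between two floored columns, any density, any `U ≥ 0`** (sharper than `objE_floor_between`): floors
`Fa ≤ e(1, a, U, n)`, `Fb ≤ e(1, b, U, n)` at `a < b` give `((b − s)·Fa + (s − a)·Fb)/(b − a) ≤ e(1, s, U, n)` for every
`s ∈ [a, b]` — `t′ ↦ e(1, t′, U, n)` is concave (`concaveOn_energyDensityTT'_tPrime`), so it lies ABOVE its chords; unlike the `min`
form there is no loss at the columns (the `min` form loses up to `|Fa − Fb|`, e.g. `≈ 0.03` on the La x = 0.30 face at `n = 7/10`).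
The chord is affine in `s`; with tangent rows `F = S + μ·n` it is bilinear in `(n, s)`. [cite: Israel1979, Thm. I.3.4] -/
theorem objE_floor_chord_between {a b s n U Fa Fb : ℝ} (hU : 0 ≤ U) (hn0 : 0 ≤ n) (hn2 : n < 2) (hab : a < b)
    (hFa : Fa ≤ energyDensityTT' 1 a U n) (hFb : Fb ≤ energyDensityTT' 1 b U n) (has : a ≤ s) (hsb : s ≤ b) :
    ((b - s) * Fa + (s - a) * Fb) / (b - a) ≤ energyDensityTT' 1 s U n := by
  have hd : 0 < b - a := by linarith
  set p : ℝ := (b - s) / (b - a) with hp'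
  set q : ℝ := (s - a) / (b - a) with hq'
  have hp : 0 ≤ p := div_nonneg (by linarith) hd.le
  have hq : 0 ≤ q := div_nonneg (by linarith) hd.le
  have hpq : p + q = 1 := by
    rw [hp', hq', ← add_div, div_eq_one_iff_eq hd.ne']
    ring
  have hc := (concaveOn_energyDensityTT'_tPrime 1 hU hn0 hn2).2 (Set.mem_univ a) (Set.mem_univ b) hp hq hpq
  simp only [smul_eq_mul] at hc
  have hs : p * a + q * b = s := by
    rw [hp', hq']
    field_simp
    ring
  rw [hs] at hc
  have e1 : ((b - s) * Fa + (s - a) * Fb) / (b - a) = p * Fa + q * Fb := by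
    rw [hp', hq']
    field_simp
  rw [e1]
  have h1 := mul_le_mul_of_nonneg_left hFa hp
  have h2 := mul_le_mul_of_nonneg_left hFb hq
  linarith

end Summit.Ventures.CertifiedManyBodySolver.Observables

end
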